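import Summits.FinalStateConjecture.FinalStateConjecture.Theorems.ZeroEnergyKerrOrBombHawkingExtensionIsKerrNHGaussNullFrame
import Literature.Geometry.Lorentzian.TracedGaussEquation
import Literature.Geometry.Lorentzian.SecondFundamentalFormSymm
import Literature.Geometry.Lorentzian.IsometryProofs
import HarnessLib

/-!
# Crux `HawkingExtensionIsKerr` (stmt-FinalStateConjecture-17840), line `SketchIdeator2` —
# programme NH: the null Gauss equation, polarised form (`stub_nh_gaussNull`)

Helper file of the line lead (c5), registered sub-goal `stub_nh_gaussNull`.  THE THEOREM
(`gauss_equation_null_localFrame`, `gauss_equation_null_pair`): for a smooth spacelike immersion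
`f : (N, f^*g) → (M, g)` of CODIMENSION TWO, an ambient vector field `K` differentiable at `f y₀`,
NORMAL to `df` near `y₀` and NULL at `f y₀`, a null `N₀ ⊥ df(T_{y₀} N)` with `g(K, N₀) ≠ 0`, and
`g(∇_{df v} K, df w) = 0` at `y₀` (the surface is totally geodesic along the null normal `K`, so
its second fundamental form is `K`-valued, hence NULL):
`(f^*g)(R(X,Y)Y, X) = g(R̄(df X, df Y) df Y, df X)` — the Gauss equation (O'Neill 1983, Ch. 4,
Thm. 5: `⟨R_{VW}X, Y⟩ = ⟨R̄_{VW}X, Y⟩ + ⟨II(V,X), II(W,Y)⟩ − ⟨II(V,Y), II(W,X)⟩`) with vanishing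
correction terms.  PROOF: that of the tree's `gauss_equation_localFrame` (`GaussEquationFrame.lean`,
hypersurface with a unit normal) verbatim — second covariant derivatives along the coordinate
rectangle, the tangential Gauss formula along the coordinate lines, metric compatibility — with the
one-normal decomposition of the cross terms replaced by the null-pair decomposition
`val_eq_inducedMetric_add_nullPair` and the normal components by
`val_covariantDerivAlong_mfderiv_localFrame_nullNormal₀` (`…NHGaussNullPrep.lean`), which vanish by
`B = 0`; then polarisation from coordinate pairs to arbitrary pairs as in `gauss_equation_pair`
(`ShrinkerSplittingAtInfinityProofs.lean`).
-/

noncomputable section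

set_option linter.dupNamespace false

namespace Summit.FinalStateConjecture.FinalStateConjecture.Theorems.HawkingExtensionIsKerr.SketchIdeator2

open Set Filter Bundle Function Manifold Literature.Geometry.Lorentzian
open Literature.Geometry.Lorentzian.PseudoRiemannianMetric
open scoped Manifold ContDiff Topology

variable {E : Type*} [NormedAddCommGroup E] [NormedSpace ℝ E] {H : Type*} [TopologicalSpace H]
  {I : ModelWithCorners ℝ E H} {M : Type*} [TopologicalSpace M] [ChartedSpace H M]
  [IsManifold I ∞ M]

section Gauss

variable [FiniteDimensional ℝ E] [CompleteSpace E]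
  (g : PseudoRiemannianMetric I ∞ E (TangentSpace I : M → Type _)) [g.HasLeviCivita]
  {E' : Type*} [NormedAddCommGroup E'] [NormedSpace ℝ E'] {H' : Type*} [TopologicalSpace H']
  {I' : ModelWithCorners ℝ E' H'} {N : Type*} [TopologicalSpace N] [ChartedSpace H' N]
  [IsManifold I' ∞ N] [FiniteDimensional ℝ E'] [CompleteSpace E'] [I'.Boundaryless] {f : N → M}
  (hpb : PseudoRiemannianMetric.contMDiff_pullbackBilin I M I' N ∞)
  (hfi : g.IsSpacelikeImmersion I' f) {K : Π x : M, TangentSpace I x}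
  {ι : Type*} [Fintype ι] [DecidableEq ι] (b' : Module.Basis ι ℝ E') {y₀ : N}
  {N₀ : TangentSpace I (f y₀)}

/-- **The null Gauss equation on an arbitrary pair of tangent vectors** (O'Neill 1983, Ch. 4,
Thm. 5 and Cor. 4.6: tensor equations hold for individual vectors).  Under the hypotheses of
`gauss_equation_null_localFrame`, for ALL `X, Y ∈ T_{y₀} N`:
`(f^*g)(R(X,Y)Y, X) = g(R̄(df X, df Y)df Y, df X)`.  A linearly independent pair is part of a chart
basis (`Module.Basis.extend`, `localFrame_trivializationAt_self`); for a dependent pair both sides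
vanish (`val_riemann_self₁₂`).  Pattern of `gauss_equation_pair`
(`ShrinkerSplittingAtInfinityProofs.lean`). -/
theorem gauss_equation_null_pair
    (hK : MDiffAt (T% K) (f y₀))
    (hn : ∀ᶠ y in 𝓝 y₀, ∀ u : TangentSpace I' y, g.val (f y) (K (f y)) (mfderiv I' I f y u) = 0)
    (hKK : g.val (f y₀) (K (f y₀)) (K (f y₀)) = 0) (hNN : g.val (f y₀) N₀ N₀ = 0)
    (hKN : g.val (f y₀) (K (f y₀)) N₀ ≠ 0)
    (hNorm0 : ∀ u : TangentSpace I' y₀, g.val (f y₀) N₀ (mfderiv I' I f y₀ u) = 0)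
    (hsff : ∀ v w : TangentSpace I' y₀,
      g.val (f y₀) (g.leviCivita K (f y₀) (mfderiv I' I f y₀ v)) (mfderiv I' I f y₀ w) = 0)
    (hdim : Module.finrank ℝ E = Module.finrank ℝ E' + 2) (X Y : TangentSpace I' y₀) :
    haveI := (g.inducedMetric f hpb hfi).hasLeviCivita
    (g.inducedMetric f hpb hfi).val y₀ ((g.inducedMetric f hpb hfi).riemann y₀ X Y Y) X =
      g.val (f y₀) (g.riemann (f y₀) (mfderiv I' I f y₀ X) (mfderiv I' I f y₀ Y)
        (mfderiv I' I f y₀ Y)) (mfderiv I' I f y₀ X) := by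
  classical
  haveI := (g.inducedMetric f hpb hfi).hasLeviCivita
  by_cases hli : LinearIndependent ℝ ![X, Y]
  · -- a linearly independent pair is part of a chart basis
    have hs : LinearIndepOn ℝ id (Set.range ![X, Y]) := hli.linearIndepOn_id
    set b := Module.Basis.extend hs with hb
    haveI : FiniteDimensional ℝ (TangentSpace I' y₀) :=
      inferInstanceAs (FiniteDimensional ℝ E')
    haveI : Finite (hs.extend (Set.subset_univ (Set.range ![X, Y]))) := Module.Finite.finite_basis b
    haveI : Fintype (hs.extend (Set.subset_univ (Set.range ![X, Y]))) := Fintype.ofFinite _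
    have hXm : X ∈ hs.extend (Set.subset_univ (Set.range ![X, Y])) :=
      Module.Basis.subset_extend hs ⟨0, rfl⟩
    have hYm : Y ∈ hs.extend (Set.subset_univ (Set.range ![X, Y])) :=
      Module.Basis.subset_extend hs ⟨1, rfl⟩
    have hG := gauss_equation_null_localFrame g hpb hfi b hK hn hKK hNN hKN hNorm0 hsff hdim
      (y₀ := y₀) ⟨X, hXm⟩ ⟨Y, hYm⟩
    have hbX : (trivializationAt E' (TangentSpace I') y₀).localFrame b ⟨X, hXm⟩ y₀ = X := by
      rw [localFrame_trivializationAt_self]; exact Module.Basis.extend_apply_self hs _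
    have hbY : (trivializationAt E' (TangentSpace I') y₀).localFrame b ⟨Y, hYm⟩ y₀ = Y := by
      rw [localFrame_trivializationAt_self]; exact Module.Basis.extend_apply_self hs _
    rw [hbX, hbY] at hG
    exact hG
  · -- a dependent pair: both sides vanish
    rw [LinearIndependent.pair_iff] at hli
    push Not at hli
    obtain ⟨s, t, hst, hne⟩ := hli
    by_cases ht : t = 0
    · have hs0 : s ≠ 0 := fun h ↦ hne h ht
      rw [ht, zero_smul, add_zero] at hst
      have hX : X = 0 := (smul_eq_zero.mp hst).resolve_left hs0
      subst hX
      have h1 : (g.inducedMetric f hpb hfi).val y₀ ((g.inducedMetric f hpb hfi).riemann y₀ 0 Y Y)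
          (0 : TangentSpace I' y₀) = 0 := map_zero _
      have h2 : mfderiv I' I f y₀ (0 : TangentSpace I' y₀) = 0 := map_zero _
      have h5 : ∀ R : TangentSpace I (f y₀), g.val (f y₀) R (0 : TangentSpace I (f y₀)) = 0 :=
        fun R ↦ map_zero _
      rw [h1, h2, h5]
    · have hY : Y = (-(s / t)) • X := by
        have h1 : t • Y = -(s • X) := eq_neg_of_add_eq_zero_right hst
        calc Y = t⁻¹ • (t • Y) := by rw [smul_smul, inv_mul_cancel₀ ht, one_smul]
          _ = (-(s / t)) • X := by rw [h1, smul_neg, smul_smul, ← neg_smul, div_eq_inv_mul]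
      subst hY
      simp only [map_smul, FunLike.coe_smul, Pi.smul_apply, smul_eq_mul, val_riemann_self₁₂,
        mul_zero]

end Gauss

/-- **Registered sub-goal form of the null Gauss equation (NH-G)** (closed statement over
`E4`-charted manifolds and surfaces modelled on `ℝ²`, crux stmt-FinalStateConjecture-17840). -/
theorem stub_nh_gaussNull : ∀ (M : Type) [TopologicalSpace M] [ChartedSpace E4 M] [IsManifold (𝓡 4) ∞ M] (g : PseudoRiemannianMetric (𝓡 4) ∞ E4 (TangentSpace (𝓡 4) : M → Type _)) [g.HasLeviCivita] (S : Type) [TopologicalSpace S] [ChartedSpace (EuclideanSpace ℝ (Fin 2)) S] [IsManifold (𝓡 2) ∞ S] (ι : S → M) (hι : g.IsSpacelikeImmersion (𝓡 2) ι) (K : Π x : M, TangentSpace (𝓡 4) x) (U : Set M) (s : S) (N : TangentSpace (𝓡 4) (ι s)), IsOpen U → ι s ∈ U → ContMDiffOn (𝓡 4) ((𝓡 4).prod 𝓘(ℝ, E4)) ∞ (fun x ↦ (Bundle.TotalSpace.mk' E4 x (K x) : TangentBundle (𝓡 4) M)) U → (∀ᶠ y in 𝓝 s, ∀ w : TangentSpace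 (𝓡 2) y, g.val (ι y) (K (ι y)) (mfderiv (𝓡 2) (𝓡 4) ι y w) = 0) → g.val (ι s) (K (ι s)) (K (ι s)) = 0 → g.val (ι s) N N = 0 → g.val (ι s) (K (ι s)) N ≠ 0 → (∀ w : TangentSpace (𝓡 2) s, g.val (ι s) N (mfderiv (𝓡 2) (𝓡 4) ι s w) = 0) → (∀ v w : TangentSpace (𝓡 2) s, g.val (ι s) (g.leviCivita K (ι s) (mfderiv (𝓡 2) (𝓡 4) ι s v)) (mfderiv (𝓡 2) (𝓡 4) ι s w) = 0) → ∀ [(g.inducedMetric ι PseudoRiemannianMetric.contMDiff_pullbackBilin_holds hι).HasLeviCivita], ∀ v w : TangentSpace (𝓡 2) s, (g.inducedMetric ι PseudoRiemannianMetric.contMDiff_pullbackBilin_holds hι).val s ((g.inducedMetric ι PseudoRiemannianMetric.contMDiff_pullbackBilin_holds hι).riemann s v w w) v = g.val (ι s) (g.riemann (ι s) (mfderiv (𝓡 2) (𝓡 4) ι s v) (mfderiv (𝓡 2) (𝓡 4) ι s w) (mfderiv (𝓡 2) (𝓡 4) ι s w)) (mfderiv (𝓡 2) (𝓡 4) ι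 s v) := by
  intro M _ _ _ g _ S _ _ _ ι hι K U s N hU hsU hKU hn hKK hNN hKN hN0 hB _ v w
  have hK : MDifferentiableAt (𝓡 4) (𝓡 4).tangent
      (fun x ↦ (TotalSpace.mk' E4 x (K x) : TangentBundle (𝓡 4) M)) (ι s) :=
    (hKU.contMDiffAt (hU.mem_nhds hsU)).mdifferentiableAt (by simp)
  have hdim : Module.finrank ℝ E4 = Module.finrank ℝ (EuclideanSpace ℝ (Fin 2)) + 2 := by
    rw [finrank_euclideanSpace_fin, finrank_euclideanSpace_fin]
  exact gauss_equation_null_pair g PseudoRiemannianMetric.contMDiff_pullbackBilin_holds hι hK hn hKK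
    hNN hKN hN0 hB hdim v w

end Summit.FinalStateConjecture.FinalStateConjecture.Theorems.HawkingExtensionIsKerr.SketchIdeator2

end
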